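import Mathlib
import Literature.Computability.AlgebraicComplexity.GroupTheoreticMatMul
import Summits.MatrixMultiplication.MatrixMultiplication.Theses.ThinBlockAlpha

/-!
# Orbit designs for `ThinPackings`: the orbit criterion and the transfer

Line `automorphism-orbit-twisted-templates` (crux-ideate r2 k4, skeleton `Ideator4Sketch`) of crux
`ThinBlockAlpha.ThinPackings` (stmt-MatrixMultiplication-10595), lead a3, 2026-08-16.

An ORBIT FAMILY indexes its blocks by a finite group `Γ` acting on the finite abelian host `H` by
additive automorphisms (`DistribMulAction Γ H`): `(A_γ, B_γ, C_γ) = (γ • A, γ • B, γ • C)` for ONE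
template `(A, B, C)`.  The ORBIT CRITERION (`isSTPP_orbitLeg_iff`): the family satisfies the tree's
simultaneous triple product property `IsSTPP` iff the template is TPP (`TemplateTPP`) and
`Γ`-TWISTED TRICOLOURED SUM-FREE (`TwistedSumFree`):
`γ • (a' − b) + δ • (b' − c) + (c' − a) ≠ 0` for all `(γ, δ) ≠ (1, 1)` and all template elements.
Proof: divide the STPP relation of labels `(i, j, k)` by `γ_k` (`twist_identity`).  The TRANSFER
(`thinPackings_of_orbitDesigns`): thin near-tight orbit designs for every shape exponent give the crux
(blocks have the template's cardinalities since each `γ • ·` is injective).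
-/

set_option linter.dupNamespace false  -- `Summit.<S>.<S>.…` is the mandated namespace

namespace Summit.MatrixMultiplication.MatrixMultiplication.Theorems.ThinPackings.Orbit

open Finset Literature.Computability.AlgebraicComplexity
open Summit.MatrixMultiplication.MatrixMultiplication.Theses.ThinBlockAlpha (ThinPackings)

section Defs

variable (Γ : Type) {H : Type} [Group Γ] [Fintype Γ] [AddCommGroup H] [DecidableEq H]
  [DistribMulAction Γ H]

/-- The `i`-th block leg of the orbit family of a template leg `S`: the image of `S` under the
`i`-th group element (in the enumeration `Fintype.equivFin Γ`). -/
noncomputable def orbitLeg (S : Finset H) (i : Fin (Fintype.card Γ)) : Finset H :=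
  S.image fun x => ((Fintype.equivFin Γ).symm i) • x

/-- The (single) triple product property of a template `(A, B, C)` in additive form:
`(a' − a) + (b' − b) + (c' − c) = 0` forces `a = a'`, `b = b'`, `c = c'`. -/
def TemplateTPP (A B C : Finset H) : Prop :=
  ∀ a ∈ A, ∀ a' ∈ A, ∀ b ∈ B, ∀ b' ∈ B, ∀ c ∈ C, ∀ c' ∈ C,
    (a' - a) + (b' - b) + (c' - c) = 0 → a = a' ∧ b = b' ∧ c = c'

/-- `Γ`-twisted tricoloured sum-freeness of a template: no cross relation
`γ • (a' − b) + δ • (b' − c) + (c' − a) = 0` with labels `(γ, δ) ≠ (1, 1)`. -/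
def TwistedSumFree (A B C : Finset H) : Prop :=
  ∀ g h : Γ, (g, h) ≠ (1, 1) →
    ∀ a' ∈ A, ∀ b ∈ B, ∀ b' ∈ B, ∀ c ∈ C, ∀ c' ∈ C, ∀ a ∈ A,
      g • (a' - b) + h • (b' - c) + (c' - a) ≠ 0

end Defs

variable {Γ H : Type} [Group Γ] [Fintype Γ] [AddCommGroup H] [DecidableEq H] [DistribMulAction Γ H]

/-- Elements of `g • S` lie in the block leg indexed by `g`. -/
theorem mem_orbitLeg (S : Finset H) (g : Γ) {x : H} (hx : x ∈ S) :
    g • x ∈ orbitLeg Γ S (Fintype.equivFin Γ g) := by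
  simp only [orbitLeg, mem_image, Equiv.symm_apply_apply]
  exact ⟨x, hx, rfl⟩

/-- Every block leg has the cardinality of its template leg (`γ • ·` is injective). -/
theorem card_orbitLeg (S : Finset H) (i : Fin (Fintype.card Γ)) :
    (orbitLeg Γ S i).card = S.card :=
  card_image_of_injective _ (MulAction.injective _)

omit [Fintype Γ] [DecidableEq H] in
/-- The algebraic identity behind the criterion: dividing a cross relation by its third label. -/
theorem twist_identity (γi γj γk : Γ) (a a' b b' c c' : H) :
    γk⁻¹ • ((γi • a' - γk • a) + (γj • b' - γi • b) + (γk • c' - γj • c)) =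
      (γk⁻¹ * γi) • (a' - b) + (γk⁻¹ * γj) • (b' - c) + (c' - a) := by
  simp only [smul_add, smul_sub, mul_smul, inv_smul_smul]
  abel

/-- **Orbit criterion.**  The orbit family of a template `(A, B, C)` under `Γ` is `IsSTPP` iff the
template is TPP and `Γ`-twisted sum-free. [new, elementary] -/
theorem isSTPP_orbitLeg_iff (A B C : Finset H) :
    IsSTPP (orbitLeg Γ A) (orbitLeg Γ B) (orbitLeg Γ C) ↔
      TemplateTPP A B C ∧ TwistedSumFree Γ A B C := by
  have hidx : ∀ g : Γ, (Fintype.equivFin Γ).symm (Fintype.equivFin Γ g) = g := fun g => by simp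
  constructor
  · intro hS
    refine ⟨?_, ?_⟩
    · intro a ha a' ha' b hb b' hb' c hc c' hc' hrel
      have h := hS (Fintype.equivFin Γ 1) (Fintype.equivFin Γ 1) (Fintype.equivFin Γ 1)
        ((1 : Γ) • a) (mem_orbitLeg A 1 ha) ((1 : Γ) • a') (mem_orbitLeg A 1 ha')
        ((1 : Γ) • b) (mem_orbitLeg B 1 hb) ((1 : Γ) • b') (mem_orbitLeg B 1 hb')
        ((1 : Γ) • c) (mem_orbitLeg C 1 hc) ((1 : Γ) • c') (mem_orbitLeg C 1 hc')
        (by simpa only [one_smul] using hrel)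
      simp only [one_smul] at h
      exact ⟨h.2.2.1, h.2.2.2.1, h.2.2.2.2⟩
    · intro g h hgh a' ha' b hb b' hb' c hc c' hc' a ha hrel
      have hh := hS (Fintype.equivFin Γ g) (Fintype.equivFin Γ h) (Fintype.equivFin Γ 1)
        ((1 : Γ) • a) (mem_orbitLeg A 1 ha) (g • a') (mem_orbitLeg A g ha')
        (g • b) (mem_orbitLeg B g hb) (h • b') (mem_orbitLeg B h hb')
        (h • c) (mem_orbitLeg C h hc) ((1 : Γ) • c') (mem_orbitLeg C 1 hc')
        (by rw [← hrel]; simp only [one_smul, smul_sub]; abel)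
      have hg : g = 1 := by
        have := congrArg (Fintype.equivFin Γ).symm (hh.1.trans hh.2.1)
        rwa [hidx, hidx] at this
      have hh' : h = 1 := by
        have := congrArg (Fintype.equivFin Γ).symm hh.2.1
        rwa [hidx, hidx] at this
      exact hgh (by rw [hg, hh'])
  · rintro ⟨hT, hTw⟩ i j k s hs s' hs' t ht t' ht' u hu u' hu' hrel
    simp only [orbitLeg, mem_image] at hs hs' ht ht' hu hu'
    obtain ⟨a, ha, rfl⟩ := hs
    obtain ⟨a', ha', rfl⟩ := hs'
    obtain ⟨b, hb, rfl⟩ := ht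
    obtain ⟨b', hb', rfl⟩ := ht'
    obtain ⟨c, hc, rfl⟩ := hu
    obtain ⟨c', hc', rfl⟩ := hu'
    have key := twist_identity ((Fintype.equivFin Γ).symm i) ((Fintype.equivFin Γ).symm j)
      ((Fintype.equivFin Γ).symm k) a a' b b' c c'
    rw [hrel, smul_zero] at key
    by_cases hgh : (((Fintype.equivFin Γ).symm k)⁻¹ * (Fintype.equivFin Γ).symm i,
        ((Fintype.equivFin Γ).symm k)⁻¹ * (Fintype.equivFin Γ).symm j) = ((1 : Γ), (1 : Γ))
    · simp only [Prod.mk.injEq, inv_mul_eq_one] at hgh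
      obtain ⟨hki, hkj⟩ := hgh
      have hik : i = k := (Fintype.equivFin Γ).symm.injective hki.symm
      have hjk : j = k := (Fintype.equivFin Γ).symm.injective hkj.symm
      subst hik; subst hjk
      simp only [inv_mul_cancel, one_smul] at key
      obtain ⟨rfl, rfl, rfl⟩ := hT a ha a' ha' b hb b' hb' c hc c' hc' (by rw [key]; abel)
      exact ⟨rfl, rfl, rfl, rfl, rfl⟩
    · exact absurd key.symm (hTw _ _ hgh a' ha' b hb b' hb' c hc c' hc' a ha)

/-- **Transfer.**  Thin near-tight ORBIT designs for every shape exponent — a finite group `Γ` of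
additive automorphisms of a finite abelian `H` and one template `(A, B, C)` of shape `⟨N, M, N⟩`,
TPP and `Γ`-twisted sum-free, with `2 ≤ N`, `N^a ≤ M`, `|H| ≤ |Γ|·N^{2+η}` — prove the crux
`ThinPackings` (the witnesses are the orbit families, `L = |Γ|`). [new, elementary] -/
theorem thinPackings_of_orbitDesigns
    (h : ∀ a : ℝ, 0 ≤ a → a < 1 → ∀ η : ℝ, 0 < η →
      ∃ (Γ H : Type) (_ : Group Γ) (_ : Fintype Γ) (_ : AddCommGroup H) (_ : Fintype H)
        (_ : DecidableEq H) (_ : DistribMulAction Γ H) (N M : ℕ) (A B C : Finset H),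
        TemplateTPP A B C ∧ TwistedSumFree Γ A B C ∧
        A.card = N ∧ B.card = M ∧ C.card = N ∧ 2 ≤ N ∧ (N : ℝ) ^ a ≤ M ∧
        (Fintype.card H : ℝ) ≤ Fintype.card Γ * (N : ℝ) ^ (2 + η)) :
    ThinPackings := by
  intro a ha0 ha1 η hη
  obtain ⟨Γ, H, _, _, _, _, _, _, N, M, A, B, C, hT, hTw, hA, hB, hC, hN, hM, hcard⟩ :=
    h a ha0 ha1 η hη
  refine ⟨H, inferInstance, inferInstance, Fintype.card Γ, N, M, orbitLeg Γ A, orbitLeg Γ B,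
    orbitLeg Γ C, (isSTPP_orbitLeg_iff A B C).2 ⟨hT, hTw⟩, fun i => ?_, hN, hM, ?_⟩
  · simp only [card_orbitLeg, hA, hB, hC, and_self]
  · exact_mod_cast hcard

/-- **Registered stub `stub_orbitTransfer`** of the line's skeleton (crux stmt-MatrixMultiplication-10595),
verbatim: orbit designs for every shape exponent give the crux. -/
theorem stub_orbitTransfer : (∀ a : ℝ, 0 ≤ a → a < 1 → ∀ η : ℝ, 0 < η → ∃ (Γ H : Type) (_ : Group Γ) (_ : Fintype Γ) (_ : AddCommGroup H) (_ : Fintype H) (_ : DecidableEq H) (_ : DistribMulAction Γ H) (N M : ℕ) (A B C : Finset H), TemplateTPP A B C ∧ TwistedSumFree Γ A B C ∧ A.card = N ∧ B.card = M ∧ C.card = N ∧ 2 ≤ N ∧ (N : ℝ) ^ a ≤ M ∧ (Fintype.card H : ℝ) ≤ Fintype.card Γ * (N : ℝ) ^ (2 + η)) → ThinPackings :=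
  fun h => thinPackings_of_orbitDesigns h

/-- The twisted clause for `Γ = GL_n(F)` acting on `n × r` matrices by left multiplication, written
with matrix products (the card's scaling family; no action instance needed). -/
def MatrixTwistedSumFree (F : Type) [Field F] (n r : ℕ)
    (A B C : Finset (Matrix (Fin n) (Fin r) F)) : Prop :=
  ∀ g h : GL (Fin n) F, (g, h) ≠ (1, 1) →
    ∀ a' ∈ A, ∀ b ∈ B, ∀ b' ∈ B, ∀ c ∈ C, ∀ c' ∈ C, ∀ a ∈ A,
      (g : Matrix (Fin n) (Fin n) F) * (a' - b) + (h : Matrix (Fin n) (Fin n) F) * (b' - c)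
        + (c' - a) ≠ 0

end Summit.MatrixMultiplication.MatrixMultiplication.Theorems.ThinPackings.Orbit
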